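import Literature.NumberTheory.EllipticCurves.Kobayashi2003.SignedSelmerModuleFiniteProofs
import Literature.NumberTheory.EllipticCurves.Tamagawa
import Literature.NumberTheory.EllipticCurves.Selmer
import HarnessLib

/-!
# Route `ThetaPartnerAtTwo` (TP2), crux K4 `SignedControlAtTwo` (stmt-BirchSwinnertonDyer-20309),
# line `eulerchar`: registered stub H4 `stub_controlOfEulerCharTwo` (Euler characteristic ⇒ control value)

HONEST FRAMING: one registered stub of the line skeleton `Cruxes/SignedControlAtTwo/Lines/eulerchar.lean`
(sha16 1799033ea9ab6fb2) proved VERBATIM; pure `Λ`-algebra (Greenberg's Lemma 4.2 on the signed dual pair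
`SignedSelmerDualData.isDualPair`, torsion automatic from `S^Γ` finite by `isTorsion_of_finite_endInvariants`, then
cancel `#(Sel⁺_∞)_Γ ≠ 0` in `ℚ₂`) — the same argument as the landed helper
`ThetaPartnerXRoute.exists_constantCoeff_eq_unit_mul_of_signedEulerChar` (p526623), re-run here so that this file
imports no route module (route-independent, Literature imports only). It closes nothing by itself: the load-bearing stub `stub_signedEulerCharTwo` (B. D. Kim's signed `Γ`-Euler characteristic READ AT
`2`) is open. BSD is not proved by any of this.

* `stub_controlOfEulerCharTwo` — for every elliptic, globally minimal `W/ℚ`, every `ℤ₂`-extension datum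
  `(κ, γ)` with `γ` a topological generator, every Pontryagin-dual datum `D` of Kobayashi's `Sel⁺(E/ℚ_∞)`
  (finitely generated, torsion), every generator `g` of `char X⁺` and `Sel_{2^∞}(E/ℚ)` finite: the signed
  Euler-characteristic identity `#S^Γ = u · 2^{v₂ ∏ c_ℓ} · #Sel_{2^∞}(E/ℚ) · #S_Γ` (with `S^Γ` finite) gives
  `g(0) = u′ · 2^{v₂ ∏ c_ℓ} · #Sel_{2^∞}(E/ℚ)`.

References: [GreenbergLNM1716] R. Greenberg, LNM 1716 (1999), §4 Lemma 4.2 (p. 102); [BDKim2013] B. D. Kim,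
J. Aust. Math. Soc. 95 (2013), Cor. 3.15; line card `Cruxes/SignedControlAtTwo/Lines/eulerchar.md`.
-/

set_option autoImplicit false
-- the Theorems namespace of this sub repeats the summit name by design (D-0017 nested layout)
set_option linter.dupNamespace false

noncomputable section

open WeierstrassCurve Literature.NumberTheory.EllipticCurves
  Literature.NumberTheory.EllipticCurves.Kobayashi2003 Literature.NumberTheory.EllipticCurves.IwasawaDual

namespace Summit.BirchSwinnertonDyer.BirchSwinnertonDyer.Cruxes.SignedControlAtTwo.EulerChar

/-- **Stub H4 of line `eulerchar` (registered signature, verbatim): Euler characteristic ⇒ control value.**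
For a Pontryagin-dual datum `D` of `Sel⁺(E/ℚ_∞)` over `Λ = ℤ₂⟦T⟧` (`T = γ - 1`), finitely generated and
torsion, with `char X⁺ = (g)`, and `Sel_{2^∞}(E/ℚ)` finite: if `S^Γ` is finite and
`#S^Γ = u · 2^{v₂ ∏ c_ℓ} · #Sel_{2^∞}(E/ℚ) · #S_Γ` (`u ∈ ℤ₂ˣ`), then
`g(0) = u′ · 2^{v₂ ∏ c_ℓ} · #Sel_{2^∞}(E/ℚ)` for some `u′ ∈ ℤ₂ˣ` — Greenberg's Lemma 4.2 for the signed dual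
pair (`g(0) · #S_Γ = u″ · #S^Γ`) and cancellation of `#S_Γ ≠ 0` in `ℚ₂`, via
`ThetaPartnerXRoute.exists_constantCoeff_eq_unit_mul_of_signedEulerChar`. The torsion hypothesis is not
used (it follows from `S^Γ` finite). [cite: GreenbergLNM1716, §4 Lemma 4.2 (p. 102)]
[cite: BDKim2013, Cor. 3.15 (p. 199)] -/
theorem stub_controlOfEulerCharTwo :
    ∀ (W : WeierstrassCurve ℚ) [W.IsElliptic] [W.IsGloballyMinimal]
      (κ : ZpExtension ℚ 2) (γ : Field.absoluteGaloisGroup ℚ), κ.IsTopGenerator γ →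
      ∀ (D : SignedSelmerDualData W κ γ 1) [Module.Finite (IwasawaAlgebra 2) D.X],
        Module.IsTorsion (IwasawaAlgebra 2) D.X → ∀ g : IwasawaAlgebra 2, D.charIdeal = Ideal.span {g} →
        Finite (W.selmerGroupPInfty 2) →
        (Finite (endInvariants (conjSignedSelmerInfty W κ 1 γ - 1)) ∧
          ∃ u : ℤ_[2]ˣ, (Nat.card (endInvariants (conjSignedSelmerInfty W κ 1 γ - 1)) : ℚ_[2]) =
            ((u : ℤ_[2]) : ℚ_[2]) * ((2 : ℕ) : ℚ_[2]) ^ (padicValNat 2 W.tamagawaProduct) *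
              (Nat.card (W.selmerGroupPInfty 2) : ℚ_[2]) *
                (Nat.card (EndCoinvariants (conjSignedSelmerInfty W κ 1 γ - 1)) : ℚ_[2])) →
        ∃ u : ℤ_[2]ˣ, ((PowerSeries.constantCoeff g : ℤ_[2]) : ℚ_[2]) =
          ((u : ℤ_[2]) : ℚ_[2]) * ((2 : ℕ) : ℚ_[2]) ^ (padicValNat 2 W.tamagawaProduct) *
            (Nat.card (W.selmerGroupPInfty 2) : ℚ_[2]) := by
  intro W _ _ κ γ hγ D _ _hX g hg _hSel hEC
  obtain ⟨hfin, u, hu⟩ := hEC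
  haveI : Finite (endInvariants (conjSignedSelmerInfty W κ 1 γ - 1)) := hfin
  have htor : Module.IsTorsion (IwasawaAlgebra 2) D.X := D.isTorsion_of_finite_endInvariants hγ hfin
  have hdp := D.isDualPair hγ
  haveI hfinC : Finite (EndCoinvariants (conjSignedSelmerInfty W κ 1 γ - 1)) :=
    hdp.finite_endCoinvariants_of_finite htor hfin
  obtain ⟨u', hu'⟩ := hdp.constantCoeff_charGenerator_mul_natCard_endCoinvariants htor g hg hfin
  have hC0 : (Nat.card (EndCoinvariants (conjSignedSelmerInfty W κ 1 γ - 1)) : ℚ_[2]) ≠ 0 := by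
    exact_mod_cast (Nat.card_pos (α := EndCoinvariants (conjSignedSelmerInfty W κ 1 γ - 1))).ne'
  -- Greenberg's Lemma 4.2 in `ℚ₂`: `g(0) · #S_Γ = u' · #S^Γ`
  have h1 : ((PowerSeries.constantCoeff g : ℤ_[2]) : ℚ_[2]) *
      (Nat.card (EndCoinvariants (conjSignedSelmerInfty W κ 1 γ - 1)) : ℚ_[2]) =
      ((u' : ℤ_[2]) : ℚ_[2]) * (Nat.card (endInvariants (conjSignedSelmerInfty W κ 1 γ - 1)) : ℚ_[2]) := by
    have h := congrArg ((↑) : ℤ_[2] → ℚ_[2]) hu'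
    simpa only [PadicInt.coe_mul, PadicInt.coe_natCast] using h
  rw [hu] at h1
  refine ⟨u' * u, ?_⟩
  apply mul_right_cancel₀ hC0
  rw [h1]
  push_cast
  ring

end Summit.BirchSwinnertonDyer.BirchSwinnertonDyer.Cruxes.SignedControlAtTwo.EulerChar

end
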